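import Mathlib.Algebra.BigOperators.Intervals
import Mathlib.Algebra.BigOperators.Ring.Finset
import Mathlib.Algebra.Order.BigOperators.Group.Finset
import Mathlib.Algebra.Order.Group.Int
import Mathlib.Data.Nat.Bitwise
import Mathlib.Data.List.Count
import Mathlib.Tactic.Ring
import Mathlib.Tactic.Linarith
import Summits.HubbardSuperconductivity.HubbardSuperconductivity.Theorems.AnisotropyChordFourTorusCore

/-!
# Route `AnisotropyChord` / crux `FerroSideChord` at `M = 4`: SEMANTICS OF THE KERNEL LOOPS AND PACKED TABLES
(prover seat `hubbard-h0-rotor-p1` g17)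

Generic lemmas turning the kernel facts of `…FourTorusKernel*` into mathematics:
* `allN_sound`, `allHalf_sound`, `all16_sound` — Boolean loops ⇒ universally quantified statements;
* `iter_add_eq`, `sumN_eq`, `sum_blocks`, `sum16_eq` — accumulator loops are `Finset` sums;
* `field_extract` — reading the `j`-th `w`-bit field of `Σ_{r<R} c_r 2^{w r}` returns `c_j` when all `c_r < 2^w`;
* `foldl_pow_eq`, `sum_pow_eq_count` — a packed table built by adding `2^{w·x}` over a list holds the multiplicities.
-/

set_option linter.style.longLine false
set_option linter.dupNamespace false
set_option autoImplicit false

open Finset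

namespace Summit.HubbardSuperconductivity.HubbardSuperconductivity.Theorems.AnisotropyChord.FourTorus

/-! ## Boolean loops -/

/-- a `false` accumulator stays `false`. [folklore] -/
theorem iter_and_false (m : ℕ) (p : ℕ → Bool) : iter m (fun i ok => ok && p i) false = false := by
  induction m with
  | zero => rfl
  | succ m ihm => rw [iter_succ, Bool.false_and]; exact ihm

/-- soundness of `allN`. [folklore] -/
theorem allN_sound {n : ℕ} {p : ℕ → Bool} (h : allN n p = true) : ∀ i < n, p i = true := by
  unfold allN at h
  induction n with
  | zero => intro i hi; omega
  | succ n ih =>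
    rw [iter_succ] at h
    cases hp : p n with
    | false => rw [hp, Bool.true_and, iter_and_false] at h; exact absurd h Bool.false_ne_true
    | true =>
      rw [hp, Bool.true_and] at h
      intro i hi
      rcases Nat.lt_succ_iff_lt_or_eq.1 hi with hi | rfl
      · exact ih h i hi
      · exact hp

/-- soundness of `allHalf`. [folklore] -/
theorem allHalf_sound {h : ℕ} {p : ℕ → Bool} (hh : allHalf h p = true) :
    ∀ k, 32768 * h ≤ k → k < 32768 * (h + 1) → p k = true := by
  intro k hk1 hk2
  unfold allHalf at hh
  have hc := allN_sound hh ((k - 32768 * h) / 256) (by omega)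
  have hj := allN_sound hc ((k - 32768 * h) % 256) (Nat.mod_lt _ (by norm_num))
  have : 256 * (128 * h + (k - 32768 * h) / 256) + (k - 32768 * h) % 256 = k := by omega
  rwa [this] at hj

/-- both halves ⇒ all codes `< 2^16`. [folklore] -/
theorem all16_sound {p : ℕ → Bool} (h0 : allHalf 0 p = true) (h1 : allHalf 1 p = true) : ∀ k < 65536, p k = true := by
  intro k hk
  by_cases hlt : k < 32768
  · exact allHalf_sound h0 k (by omega) (by omega)
  · exact allHalf_sound h1 k (by omega) (by omega)

/-! ## Accumulator sums -/

/-- an additive accumulator loop is a `Finset` sum. [folklore] -/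
theorem iter_add_eq {β : Type} [AddCommMonoid β] (n : ℕ) (g : ℕ → β) (a : β) :
    iter n (fun i s => s + g i) a = a + ∑ i ∈ range n, g i := by
  induction n generalizing a with
  | zero => simp [iter_zero]
  | succ n ih =>
    rw [iter_succ, ih, sum_range_succ, add_assoc, add_comm (g n)]

/-- `sumN` is a `Finset` sum. [folklore] -/
theorem sumN_eq (n : ℕ) (g : ℕ → ℕ) : sumN n g = ∑ i ∈ range n, g i := by
  unfold sumN; rw [iter_add_eq, zero_add]

/-- blocks: `Σ_{c<a} Σ_{j<b} g(b c + j) = Σ_{k < a b} g k`. [folklore] -/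
theorem sum_blocks {β : Type} [AddCommMonoid β] (a b : ℕ) (g : ℕ → β) :
    ∑ c ∈ range a, ∑ j ∈ range b, g (b * c + j) = ∑ k ∈ range (a * b), g k := by
  induction a with
  | zero => simp
  | succ a ih =>
    rw [sum_range_succ, ih, show (a + 1) * b = a * b + b by ring, Finset.sum_range_add]
    congr 1
    exact Finset.sum_congr rfl fun j _ => by rw [mul_comm]

/-- `sum16` is the sum over `k < 2^16`. [folklore] -/
theorem sum16_eq (g : ℕ → ℕ) : sum16 g = ∑ k ∈ range 65536, g k := by
  unfold sum16
  rw [sumN_eq]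
  simp_rw [sumN_eq]
  rw [sum_blocks]

/-! ## Packed fields -/

/-- `field w N i = N / 2^(w i) % 2^w`. [folklore] -/
theorem field_eq (w N i : ℕ) : field w N i = N / 2 ^ (w * i) % 2 ^ w := by
  unfold field; rw [Nat.shiftRight_eq_div_pow]

/-- **field extraction:** the `j`-th `w`-bit field of `Σ_{r<R} c_r 2^{w r}` is `c_j` (`j < R`, all `c_r < 2^w`). [folklore] -/
theorem field_extract (w : ℕ) (c : ℕ → ℕ) (hc : ∀ r, c r < 2 ^ w) :
    ∀ (R j : ℕ), j < R → field w (∑ r ∈ range R, c r * 2 ^ (w * r)) j = c j := by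
  -- peel off the lowest field: `Σ_{r<R+1} c_r B^r = c_0 + B · Σ_{r<R} c_{r+1} B^r`
  have hB : 0 < 2 ^ w := Nat.two_pow_pos w
  have peel : ∀ (c : ℕ → ℕ) (R : ℕ), ∑ r ∈ range (R + 1), c r * 2 ^ (w * r)
      = c 0 + 2 ^ w * ∑ r ∈ range R, c (r + 1) * 2 ^ (w * r) := by
    intro c R
    rw [Finset.sum_range_succ', Nat.mul_zero, pow_zero, mul_one, add_comm, Finset.mul_sum]
    congr 1
    exact Finset.sum_congr rfl fun r _ => by rw [Nat.mul_succ, pow_add]; ring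
  intro R
  induction R generalizing c with
  | zero => intro j hj; omega
  | succ R ih =>
    intro j hj
    rw [field_eq, peel]
    cases j with
    | zero =>
      rw [Nat.mul_zero, pow_zero, Nat.div_one, Nat.add_mul_mod_self_left, Nat.mod_eq_of_lt (hc 0)]
    | succ j =>
      have h1 : (c 0 + 2 ^ w * ∑ r ∈ range R, c (r + 1) * 2 ^ (w * r)) / 2 ^ (w * (j + 1))
          = (∑ r ∈ range R, c (r + 1) * 2 ^ (w * r)) / 2 ^ (w * j) := by
        rw [Nat.mul_succ, pow_add, mul_comm (2 ^ (w * j)) (2 ^ w), ← Nat.div_div_eq_div_mul,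
          Nat.add_mul_div_left _ _ hB, Nat.div_eq_of_lt (hc 0), zero_add]
      rw [h1]
      have := ih (fun r => c (r + 1)) (fun r => hc (r + 1)) j (by omega)
      rw [field_eq] at this
      exact this

/-- an additive `foldl` with powers is the accumulator plus the mapped sum. [folklore] -/
theorem foldl_pow_eq {α : Type} (f : α → ℕ) (l : List α) (acc : ℕ) :
    l.foldl (fun a x => a + f x) acc = acc + (l.map f).sum := by
  induction l generalizing acc with
  | nil => simp
  | cons x l ih => rw [List.foldl_cons, ih, List.map_cons, List.sum_cons]; ring

/-- the mapped power sum of a list of indices `< R` counts multiplicities. [folklore] -/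
theorem sum_pow_eq_count (w R : ℕ) (l : List ℕ) (hl : ∀ x ∈ l, x < R) :
    (l.map fun x => 2 ^ (w * x)).sum = ∑ r ∈ range R, l.count r * 2 ^ (w * r) := by
  induction l with
  | nil => simp
  | cons x l ih =>
    rw [List.map_cons, List.sum_cons, ih (fun y hy => hl y (List.mem_cons_of_mem _ hy))]
    have hx : x < R := hl x (by simp)
    rw [show (2 : ℕ) ^ (w * x) = ∑ r ∈ range R, (if r = x then 1 else 0) * 2 ^ (w * r) by
      simp_rw [ite_mul, one_mul, zero_mul]; rw [Finset.sum_ite_eq']; simp [hx]]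
    rw [← Finset.sum_add_distrib]
    refine Finset.sum_congr rfl fun r _ => ?_
    rw [List.count_cons]
    by_cases h : r = x
    · subst h; simp; ring
    · have : (x == r) = false := by simpa [beq_iff_eq] using fun h' => h h'.symm
      simp [h, this]

/-- fiberwise form of an indicator power sum over a range: `Σ_{k<N, P k} 2^{w g k} = Σ_{r<R} #{k<N : P k ∧ g k = r}·2^{w r}`
when `P k → g k < R`. [folklore] -/
theorem sum_indicator_pow_eq (w R N : ℕ) (P : ℕ → Prop) [DecidablePred P] (g : ℕ → ℕ) (hg : ∀ k < N, P k → g k < R) :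
    ∑ k ∈ range N, (if P k then 2 ^ (w * g k) else 0)
      = ∑ r ∈ range R, ((range N).filter fun k => P k ∧ g k = r).card * 2 ^ (w * r) := by
  rw [show (∑ k ∈ range N, (if P k then 2 ^ (w * g k) else 0))
      = ∑ k ∈ (range N).filter P, 2 ^ (w * g k) by rw [Finset.sum_filter]]
  rw [← Finset.sum_fiberwise_of_maps_to (s := (range N).filter P) (t := range R) (g := g)
      (fun k hk => by
        rw [Finset.mem_filter, Finset.mem_range] at hk
        exact mem_range.2 (hg k hk.1 hk.2))]
  refine Finset.sum_congr rfl fun r _ => ?_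
  rw [Finset.sum_const_nat (m := 2 ^ (w * r)) (fun k hk => by
      rw [Finset.mem_filter] at hk; rw [hk.2])]
  congr 2
  ext k; simp [Finset.mem_filter, and_assoc]

end Summit.HubbardSuperconductivity.HubbardSuperconductivity.Theorems.AnisotropyChord.FourTorus
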